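import Summits.NavierStokesRegularity.NavierStokesRegularity.Theses.PalasekTowerBreakdown
import Summits.NavierStokesRegularity.FluidComputer.PalasekTowerHeredityWitnessRungs

/-!
# NavierStokesRegularity — route `PalasekTowerBreakdown`, item `EpisodeBase`: the base from a prepared host's own witness

Supports `stmt-NavierStokesRegularity-19179` (`EpisodeBase` = K1G `EpisodeBaseG` = `RungG 1`; it does
NOT close it). Cell `ns-blowup`, seat `ns-blowup-ecbridge-6` (D-0074 GROUP C «BRIDGE SUPPORT»). In
the route's OWN vocabulary:

  `TaoForcedUniqueness → (∃ prepared host S with a level-0 witness) → EpisodeBase`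
  `TaoForcedUniqueness → RungG 0 → HeredityWitness 0 → EpisodeBase`

— a prepared host is a pinned rigid quiet wide design with a registered G-stage at level `0` (the base
skeleton's stub `host_preparation` = `RungG 0`); its level-`0` WITNESS
(`…PalasekTowerClayBridge.Schedule.LevelWitness S 1 0`: its own classical finite-energy flow from
the Clay datum under the design force reaches `τ 1` below `(5/3) Y₁` on `[τ 0, τ 1]` and shows at
`τ 1`, in the ball, a point of speed `≥ Y₁ ≈ 2778`, a point of strain `≥ A₁ ≈ 1.24·10⁶` and the
`N₁`-core loop, `N₁ = 256^{1.1}`) gives the base — an existential, certificate-shaped door that does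
not pass through the universal stub `first_episode` (= p415576's `HeredityAt 0`). Kernel content:
`episodeBaseG_of_levelWitness_zero` / `episodeBaseG_of_rungG_zero_of_heredityWitness_W14`
(FluidComputer/PalasekTowerHeredityWitnessRungs.lean p418125). MODEL words are analogues of the
witness, never instances; nothing is asserted.

WHAT THIS IS NOT: not NS — a conditional reduction; no stage, flow or tower is constructed.
-/

-- `Summit.<Summit>.<Problem>` is the tree's mandated summit-side namespace (CONVENTIONS §2); for this
-- single-conjunct summit the two coincide, so the duplicate is deliberate.
set_option linter.dupNamespace false

namespace Summit.NavierStokesRegularity.NavierStokesRegularity.Theorems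

open Summit.NavierStokesRegularity.NavierStokesRegularity.Theses
open Summit.NavierStokesRegularity.FluidComputer.PalasekTowerClayBridge

/-- **Item `EpisodeBase` from the route's uniqueness item and ONE prepared host with its own
level-`0` witness**. [cite: Tao2011, Cor. 11.4] -/
theorem palasekTowerBreakdown_episodeBase_of_levelWitness_zero
    (hU : PalasekTowerBreakdown.TaoForcedUniqueness)
    (h : ∃ S : Schedule TowerRates.wide, S.Pins 8 (6 / 5) ∧ S.Rigid ∧ S.Quiet ∧
      Nonempty (Stage 1 TowerRates.wide S (Margins.routeG TowerRates.wide) 0) ∧ S.LevelWitness 1 0) :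
    PalasekTowerBreakdown.EpisodeBase := by
  unfold PalasekTowerBreakdown.EpisodeBase
  unfold PalasekTowerBreakdown.TaoForcedUniqueness at hU
  exact episodeBaseG_of_levelWitness_zero
    (Literature.Analysis.FluidPDE.tao2011_forced_unconditionalUniqueness_velocity.schwartzForce hU) h

/-- **Item `EpisodeBase` from the route's uniqueness item, host preparation (`RungG 0`) and the typed
heredity witness at level `0`** — the base skeleton's composition with its universal stub
`first_episode` replaced by the witness form. [cite: Tao2011, Cor. 11.4] -/
theorem palasekTowerBreakdown_episodeBase_of_rungG_zero_of_heredityWitness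
    (hU : PalasekTowerBreakdown.TaoForcedUniqueness) (h₀ : RungG 0) (h : HeredityWitness 0) :
    PalasekTowerBreakdown.EpisodeBase := by
  unfold PalasekTowerBreakdown.EpisodeBase
  unfold PalasekTowerBreakdown.TaoForcedUniqueness at hU
  exact episodeBaseG_of_rungG_zero_of_heredityWitness_W14 hU h₀ h

/-- The free direction: the base's own design carries a level-`0` witness (restrict its level-`1`
stage; no uniqueness). [folklore] -/
theorem palasekTowerBreakdown_levelWitness_zero_of_episodeBase
    (h : PalasekTowerBreakdown.EpisodeBase) :
    ∃ S : Schedule TowerRates.wide, S.Pins 8 (6 / 5) ∧ S.Rigid ∧ S.Quiet ∧ S.LevelWitness 1 0 := by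
  unfold PalasekTowerBreakdown.EpisodeBase at h
  exact (rungG_one_iff.2 h).levelWitness_of_lt Nat.zero_lt_one

end Summit.NavierStokesRegularity.NavierStokesRegularity.Theorems
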